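import Literature.MathematicalPhysics.QuantumLattice.HubbardSectorFieldSubstitution
import Literature.MathematicalPhysics.QuantumLattice.HubbardGridFieldSubstitution
import HarnessLib

/-!
# The overlap kernel of the sector ANALYSIS map after the position–time GRID substitution

Topic `MathematicalPhysics/QuantumLattice`; companion of `HubbardSectorFieldSubstitution.lean` (the sector analysis matrix
`E = sectorAnalysisMatrix β F`: `ψ̂^c_{k,σ} ↦ Σ_{x,ω} F_ω(k) e^{-is_c k·x} ψ'_{(x,((ω,σ),c))}`, whose kernels are BGM's sectorised
position-space kernels on the dual time lattice `SpaceTimeIdx L M`) and `HubbardGridFieldSubstitution.lean` (the substitution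
`S = gridSubMatrix β x τ` of the position–time fields at an arbitrary family of points `(x⃗_p, τ_p)`, `p ∈ P` — in particular the
`N`-point time grid `hubbardGridSub β N` on which the ultraviolet integration is performed).  When the single-scale step is RUN in
the grid fields (substitution `S`) and its output is READ through the sector analysis `E` (Benfatto–Giuliani–Mastropietro 2006,
§2.7 (2.70)–(2.71): `𝔉_{m,h,Ω} *`), the representation theorems
(`GrassmannEffectiveActionRepresentation.kernelNorm_kernel_map_effAction_le`, graded twin
`GrassmannEffectiveActionGradedDB.kernelNorm_kernel_map_effAction_le_pow_of_gramBounded_quartic`) charge the row and column sums of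
`‖E S‖`.  This file computes `E S` and reduces those sums to the `ℓ¹` sizes of ONE cross-grid multiplier kernel:

* `sectorAnalysis_mul_gridSub_apply` — `(E S)((y,((ω,σ'),c')), ((p,σ),c)) = [σ = σ' ∧ c = c'] (βL²)⁻¹ Σ_k F_ω(k) e^{-is_c k·y}
  conj(e^{-is_c k·(x⃗_p,τ_p)})` (one multiplier, the phase of the DIFFERENCE of the two space–time points; (2.71) with (2.5));
* `sum_gridLeg_eq` — bookkeeping of the grid-side labels;
* **`rowSum_sectorAnalysis_mul_gridSub_le`** — if the `p`-sum of the norms of one kernel at fixed `(ω, σ, c, y)` is `≤ B`, every row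
  sum of `‖E S‖` is `≤ B` (the `cr` of the representation theorem);
* **`colSum_sectorAnalysis_mul_gridSub_le`** — if the `(ω, y)`-sum at fixed `(σ, c, p)` is `≤ B'`, every column sum is `≤ B'` (the `cc`).

Everything is proved; no definitions, no named facts (the `ℓ¹` sizes `B, B'` — the "sector lemma" `∫|F̌_{h,ω}| ≤ C` of (2.71a)
on the two grids — are hypotheses here).

## Sources

G. Benfatto, A. Giuliani, V. Mastropietro, Ann. Henri Poincaré 7 (2006) 809–898 = arXiv:cond-mat/0507686, §2.1 (2.5), §2.5
(2.48), §2.7 (2.70)–(2.71a) [`BenfattoGiulianiMastropietro2006`]; M. Salmhofer, *Renormalization* (1999), §4.2.4 (4.55)–(4.58)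
(the time grid) [`Salmhofer1999`].
-/

noncomputable section

namespace Literature.MathematicalPhysics.QuantumLattice

open Finset Literature.Probability.LatticeModels

variable {L M : ℕ} [NeZero L] {N : ℕ} {P : Type*}

/-- **The overlap kernel of sector analysis after the grid substitution** (BGM 2006, (2.71) with (2.5)):
`(E S)((y,((ω,σ'),c')), ((p,σ),c)) = [σ = σ' ∧ c = c'] Σ_k F_ω(k) e^{-is_c k·y} · (βL²)⁻¹ conj(e^{-is_c k·(x⃗_p,τ_p)})` — one
multiplier `F_ω`, read at the phase difference of the dual-lattice point `y` and the grid point `(x⃗_p, τ_p)`.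
[cite: BenfattoGiulianiMastropietro2006, §2.7 (2.71)] -/
theorem sectorAnalysis_mul_gridSub_apply (β : ℝ) (F : Fin N → FreqMomentum L M → ℂ) (x : P → TorusSite 2 L) (τ : P → ℝ)
    (Y' : SpaceTimeIdx L M × SectorLeg N) (Y : GridLeg P) :
    (sectorAnalysisMatrix L M β F * gridSubMatrix L M β x τ) Y' Y =
      if Y.1.2 = Y'.2.1.2 ∧ Y.2 = Y'.2.2 then
        ∑ k : FreqMomentum L M, F Y'.2.1.1 k * hubbardPlaneWave L M β Y'.2.2 k Y'.1 *
          (((1 / (β * (L : ℝ) ^ 2) : ℝ) : ℂ) * (starRingEnd ℂ) (vertexPlaneWave L M β Y.2 k (x Y.1.1) (τ Y.1.1)))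
      else 0 := by
  rw [Matrix.mul_apply]
  have h1 : ∀ K : HubbardFieldIdx L M, sectorAnalysisMatrix L M β F Y' K * gridSubMatrix L M β x τ K Y =
      if K.1.2 = Y'.2.1.2 ∧ K.2 = Y'.2.2 then
        (if Y.1.2 = Y'.2.1.2 ∧ Y.2 = Y'.2.2 then F Y'.2.1.1 K.1.1 * hubbardPlaneWave L M β Y'.2.2 K.1.1 Y'.1 *
          (((1 / (β * (L : ℝ) ^ 2) : ℝ) : ℂ) * (starRingEnd ℂ) (vertexPlaneWave L M β Y.2 K.1.1 (x Y.1.1) (τ Y.1.1)))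
          else 0) else 0 := by
    intro K
    rw [sectorAnalysisMatrix_apply, gridSubMatrix_apply]
    by_cases hK : K.1.2 = Y'.2.1.2 ∧ K.2 = Y'.2.2
    · rw [if_pos hK, if_pos hK]
      by_cases hY : Y.1.2 = Y'.2.1.2 ∧ Y.2 = Y'.2.2
      · rw [if_pos hY, if_pos ⟨hK.1.trans hY.1.symm, hK.2.trans hY.2.symm⟩]
      · rw [if_neg hY, if_neg (fun h => hY ⟨h.1.symm.trans hK.1, h.2.symm.trans hK.2⟩), mul_zero]
    · rw [if_neg hK, if_neg hK, zero_mul]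
  simp_rw [h1]
  rw [sum_fieldIdx_ite]
  split_ifs with hY
  · rfl
  · exact sum_const_zero

/-- The sum over the grid-side labels `((p, σ), c)`, split into point, spin and charge. [folklore] -/
private theorem sum_gridLeg_eq [Fintype P] (f : GridLeg P → ℝ) :
    ∑ Y, f Y = ∑ p : P, ∑ σ : Fin 2, ∑ c : Fin 2, f ((p, σ), c) := by
  rw [Fintype.sum_prod_type, Fintype.sum_prod_type]

/-- **Row sum (`cr`) ≤ one-kernel size on the grid.**  If for every row label `(y, ((ω,σ),c))` the `p`-sum of the norms of the
overlap kernel over the grid points is `≤ B`, then every row sum of `‖E S‖` is `≤ B` (only the legs of the row's own spin and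
charge contribute). [cite: BenfattoGiulianiMastropietro2006, §2.7 (2.71a)] -/
theorem rowSum_sectorAnalysis_mul_gridSub_le [Fintype P] (β : ℝ) (F : Fin N → FreqMomentum L M → ℂ)
    (x : P → TorusSite 2 L) (τ : P → ℝ) {B : ℝ}
    (hB : ∀ (ω : Fin N) (σ c : Fin 2) (y : SpaceTimeIdx L M),
      ∑ p : P, ‖(sectorAnalysisMatrix L M β F * gridSubMatrix L M β x τ) (y, ((ω, σ), c)) ((p, σ), c)‖ ≤ B)
    (Y' : SpaceTimeIdx L M × SectorLeg N) :
    ∑ Y, ‖(sectorAnalysisMatrix L M β F * gridSubMatrix L M β x τ) Y' Y‖ ≤ B := by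
  obtain ⟨y, ⟨ω, σ'⟩, c'⟩ := Y'
  rw [sum_gridLeg_eq]
  -- only `(σ, c) = (σ', c')` contributes
  have hvan : ∀ (p : P) (σ c : Fin 2), ¬ (σ = σ' ∧ c = c') →
      ‖(sectorAnalysisMatrix L M β F * gridSubMatrix L M β x τ) (y, ((ω, σ'), c')) ((p, σ), c)‖ = 0 := by
    intro p σ c hne
    rw [sectorAnalysis_mul_gridSub_apply, if_neg (by simpa using hne), norm_zero]
  have hp : ∀ p : P, ∑ σ : Fin 2, ∑ c : Fin 2,
      ‖(sectorAnalysisMatrix L M β F * gridSubMatrix L M β x τ) (y, ((ω, σ'), c')) ((p, σ), c)‖ =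
      ‖(sectorAnalysisMatrix L M β F * gridSubMatrix L M β x τ) (y, ((ω, σ'), c')) ((p, σ'), c')‖ := by
    intro p
    rw [Finset.sum_eq_single σ', Finset.sum_eq_single c']
    · intro c _ hc; exact hvan p σ' c (by simp [hc])
    · simp
    · intro σ _ hσ; exact Finset.sum_eq_zero fun c _ => hvan p σ c (by simp [hσ])
    · simp
  simp_rw [hp]
  exact hB ω σ' c' y

/-- **Column sum (`cc`) ≤ one-kernel size on the dual lattice, summed over the sectors.**  If for every column label
`((p,σ),c)` the `(ω, y)`-sum of the norms of the overlap kernel is `≤ B'`, then every column sum of `‖E S‖` is `≤ B'`.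
[cite: BenfattoGiulianiMastropietro2006, §2.7 (2.71a)] -/
theorem colSum_sectorAnalysis_mul_gridSub_le [Fintype P] (β : ℝ) (F : Fin N → FreqMomentum L M → ℂ)
    (x : P → TorusSite 2 L) (τ : P → ℝ) {B' : ℝ}
    (hB' : ∀ (σ c : Fin 2) (p : P),
      ∑ ω : Fin N, ∑ y : SpaceTimeIdx L M,
        ‖(sectorAnalysisMatrix L M β F * gridSubMatrix L M β x τ) (y, ((ω, σ), c)) ((p, σ), c)‖ ≤ B')
    (Y : GridLeg P) :
    ∑ Y', ‖(sectorAnalysisMatrix L M β F * gridSubMatrix L M β x τ) Y' Y‖ ≤ B' := by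
  obtain ⟨⟨p, σ⟩, c⟩ := Y
  have hsplit : ∑ Y' : SpaceTimeIdx L M × SectorLeg N,
      ‖(sectorAnalysisMatrix L M β F * gridSubMatrix L M β x τ) Y' ((p, σ), c)‖ =
      ∑ ω : Fin N, ∑ σ' : Fin 2, ∑ c' : Fin 2, ∑ y : SpaceTimeIdx L M,
        ‖(sectorAnalysisMatrix L M β F * gridSubMatrix L M β x τ) (y, ((ω, σ'), c')) ((p, σ), c)‖ := by
    rw [Fintype.sum_prod_type, Finset.sum_comm, Fintype.sum_prod_type, Fintype.sum_prod_type]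
  rw [hsplit]
  -- only `(σ', c') = (σ, c)` contributes
  have hvan : ∀ (ω : Fin N) (σ' c' : Fin 2) (y : SpaceTimeIdx L M), ¬ (σ' = σ ∧ c' = c) →
      ‖(sectorAnalysisMatrix L M β F * gridSubMatrix L M β x τ) (y, ((ω, σ'), c')) ((p, σ), c)‖ = 0 := by
    intro ω σ' c' y hne
    rw [sectorAnalysis_mul_gridSub_apply, if_neg (by
      rintro ⟨h1, h2⟩
      exact hne ⟨h1.symm, h2.symm⟩), norm_zero]
  have hω : ∀ ω : Fin N, ∑ σ' : Fin 2, ∑ c' : Fin 2, ∑ y : SpaceTimeIdx L M,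
      ‖(sectorAnalysisMatrix L M β F * gridSubMatrix L M β x τ) (y, ((ω, σ'), c')) ((p, σ), c)‖ =
      ∑ y : SpaceTimeIdx L M, ‖(sectorAnalysisMatrix L M β F * gridSubMatrix L M β x τ) (y, ((ω, σ), c)) ((p, σ), c)‖ := by
    intro ω
    rw [Finset.sum_eq_single σ, Finset.sum_eq_single c]
    · intro c' _ hc; exact Finset.sum_eq_zero fun y _ => hvan ω σ c' y (by simp [hc])
    · simp
    · intro σ' _ hσ; exact Finset.sum_eq_zero fun c' _ => Finset.sum_eq_zero fun y _ => hvan ω σ' c' y (by simp [hσ])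
    · simp
  simp_rw [hω]
  exact hB' σ c p

/-- **The overlap kernel for the `N`-point time grid** (`hubbardGridSub β N`, points `(j, x⃗)`, times `jβ/N`): the same formula
with `(x⃗_p, τ_p) = (x⃗, jβ/N)`. [cite: BenfattoGiulianiMastropietro2006, §2.7 (2.71)] -/
theorem sectorAnalysis_mul_hubbardGridSub_apply (β : ℝ) (F : Fin N → FreqMomentum L M → ℂ) (Ng : ℕ)
    (Y' : SpaceTimeIdx L M × SectorLeg N) (Y : GridLeg (GridPoint L Ng)) :
    (sectorAnalysisMatrix L M β F * hubbardGridSub L M β Ng) Y' Y =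
      if Y.1.2 = Y'.2.1.2 ∧ Y.2 = Y'.2.2 then
        ∑ k : FreqMomentum L M, F Y'.2.1.1 k * hubbardPlaneWave L M β Y'.2.2 k Y'.1 *
          (((1 / (β * (L : ℝ) ^ 2) : ℝ) : ℂ) * (starRingEnd ℂ) (vertexPlaneWave L M β Y.2 k Y.1.1.2 (gridTime β Ng Y.1.1.1)))
      else 0 :=
  sectorAnalysis_mul_gridSub_apply β F _ _ Y' Y

end Literature.MathematicalPhysics.QuantumLattice

end
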